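import Mathlib
import HarnessLib
import HarnessLib.Audit
import Summits.CriticalPhenomena.Statement

/-!
Route: PlantedPinning

DORMANT since 2026-09-03T14:42:36Z (reconciler: no traction for 5 d (last activity statement-checked at 2026-08-29T14:02:40Z); parked, not closed — `ledger route dormant route-CriticalPhenomena-PlantedPinning --off` to reactivate) — unstaffed, not closed; items shared with open routes are served there. `ledger route dormant <id> --off` reactivates.

# Route PlantedPinning — pin the critical point to itself — the planted-pinning efficiency e(p) ≤ 1
is GFF-saturated, and a deficit e* < 1 certifies U₄ ≢ 0

It suffices to show X_PP = PinningEfficiencyDeficit ∧ GaussianPinningSaturation ∧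
MoebiusLimitExists, realising card
planted-pinning-nishimori-axis (spine; its K3(b) + "e* < 1" strand, with the pinning-lemma CEILING
as provable-now support).
OBJECT (all finite-volume, all existing declarations): draw σ* from the critical + box measure
μ⁺_{Λ_L;β_c(3)} (Λ_L = box 3 L,
n = |Λ_L|), pin a uniformly random k-subset P ⊆ Λ_L to the planted values σ*_P — the conditioned law
is EXACTLY
isingMeasure (zdGraph 3) (Λ_L ∖ P) β_c 0 (.fixed σ*) (finite-volume DLR) — and let v_{L,k} := E
Var(M_Λ | σ_P) be the planted
conditional variance of the total spin, e_L(k) := k·v_{L,k}/((n+1)(n−k+1)) the PINNING EFFICIENCY.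
The pinning lemma (Montanari 2008,
Raghavendra–Tan 2012) gives 0 ≤ e_L(k) ≤ 1 for EVERY law on {±1}^n (support items), and the massless
lattice GFF saturates it
(e → 1: conditioning a Gaussian vector is value-blind, trap hitting times homogenise). With k = ⌈p
n⌉ and L → ∞ before p → 0⁺,
e ≈ p·χ_pin(p), χ_pin(p) = E Σ_x Cov(σ₀,σ_x | pins) the planted susceptibility (card notation).
PinningEfficiencyDeficit (r2): limsup_{p→0} limsup_L e_L(⌈pn⌉) < 1 ("e* < 1": the critical 3D state
is pinned strictly less
efficiently than a Gaussian field — positive Cauchy–Schwarz slack = intermittency of the local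
conditional susceptibility at the
screening scale L*(p) ≍ p^{−1/(d−2Δ_σ)}).
GaussianPinningSaturation (r3): if some non-degenerate Möbius-covariant pointwise scaling limit S of
criticalCorr 3 has U₄ ≡ 0 on
non-coincident configurations, then e → 1 (liminf_{p→0} liminf_L e_L ≥ 1 − ε for every ε).
MoebiusLimitExists (r5, imported complement = the conjunct minus clause (iii), verbatim the shared
item of PerfectScreening /
DiracCensus / GammaForcesInteraction).
Lean: `PinningEfficiencyDeficit ∧ GaussianPinningSaturation ∧ MoebiusLimitExists`

## Assembly
Pure logic (theorem assembly_glue in the planner's Sketch.lean, sorry-free, rc 0):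
MoebiusLimitExists gives (ρ, Δ, S) with every
hypothesis of GaussianPinningSaturation except U₄ ≡ 0; if HasNontrivialU4 S failed, saturation with
ε/2 and the deficit with ε give,
at p = min(p₀,p₁)/2 and L = max(L₀,L₁), both e ≤ 1 − ε and 1 − ε/2 ≤ e — contradiction; hence
HasNontrivialU4 S and
⟨ρ, Δ, S, …⟩ is Ising3DConformalLimit (= Literature CritIsing3DConformalLimit).
PlantedSusceptibilityFloor and the two support
items are not antecedents: the floor guards r2/r3 against the degenerate scenario e → 0, the
supports fix 0 ≤ e ≤ 1.

Rationale: WHY THIS LINE. The card's planted-pinning axis (condition the critical state on an erasure-channel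
sample of ITSELF: β stays β_c, no field, no
block rule; exact tower/Nishimori identities, every member an FKG ferromagnet with pins) is the
typical-configuration complement of the
non-Gibbsian obstruction, and physically it is the "partial quench / Bayesian conditioned ensemble"
of Nahum–Jacobsen (arXiv:2504.01264
§2.6.1, §3.1, §10.1: spin measurement of critical Ising is RG-relevant, x_σ < d/2, and flows to
replica locking; crossover length
λ^{−1/(d−2x_σ)}), so χ_pin ≍ 1/p is hyperscaling on that axis (γ/ν = 2−η = d−2Δ_σ). What is imported
here from INFERENCE / theoretical
CS is the pinning lemma (arXiv:0709.0145; doi:10.1137/1.9781611973099.33; El Alaoui–Montanari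
arXiv:2109.00709 eqs. (1.4)–(1.6)): one
random pin lowers E Var(M|pins) by ≥ (E Var)²/(n−k)² (exact one-pin identity for binary spins,
Cauchy–Schwarz, Jensen), a Riccati
inequality in the pin number whose solution is the interaction- and dimension-free CEILING e ≤ 1,
saturated exactly by Gaussian
lattice fields; the slack 1 − e is therefore a bounded, replica-Monte-Carlo-measurable gauge of
non-Gaussianity of the CROSSOVER, and
the bet (r2/r3) is that it separates the interacting 3D fixed point (e* < 1) from every Gaussian
scenario (e* = 1), delivering clause
(iii) of the conjunct from a lattice inequality rather than from double-current intersections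
(AizenmanDuminilCopinAnnals2021) or
two-point asymptotics (PerfectScreening, AnomalousForcesInteraction). No prior route conditions the
critical state on a random sample of itself or uses a
measure-decomposition/pinning-lemma argument; the negatives index (one SAW item) is not touched;
statements are finite sums over
isingWeight/isingExpect, so the import cone carries no unproved named fact and no limUnder junk.

RANKED CRUXES. #2 PinningEfficiencyDeficit (crux) — e* < 1 for the critical n.n. Ising model on ℤ³
(card "e* < 1", the content of K3(b)'s criterion): there are ε > 0 and p₀ > 0 such that for every p
∈ (0, p₀), for all L large, e_L(⌈p·|box 3 L|⌉) ≤ 1 − ε, where e_L(k) = k·v_{L,k}/((n+1)(n−k+1)) and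
v_{L,k} is the planted conditional variance of M_Λ = Σ_{x∈Λ_L} σ_x averaged over uniform k-subsets P
and over σ* ~ μ⁺_{Λ_L;β_c(3),0} (conditional law = Ising measure on Λ_L∖P with boundary condition
fixed to glue Λ_L σ* plus). [difficulty: open-problem] (why it might fail: e*=1 iff the
Cauchy–Schwarz slack (spatial variance of the local conditional susceptibility at scale L*(p))
vanishes; an LLN over the ≍p^{−1/2} pins in a screening ball might force that even at the
interacting fixed point; evidence is only MC at L=28 (p·χ≈0.4–0.8) and 2D (≈0.27).)
[arXiv:2504.01264, doi:10.1137/1.9781611973099.33, arXiv:0709.0145, arXiv:2109.00709,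
DuminilCopinICM2022]
#3 GaussianPinningSaturation (crux) — Gaussian ⇒ saturation (card K3(b)): if (ρ, Δ, S) is a
pointwise scaling limit of criticalCorr 3 with ρ > 0 on (0,1], Δ > 0, non-degenerate two-point
function, Möbius covariant, and with connected four-point function vanishing on all non-coincident
configurations, then for every ε > 0 there is p₀ > 0 such that for every p ∈ (0,p₀), for all L
large, 1 − ε ≤ e_L(⌈p·|box 3 L|⌉). Benchmark: for the massless lattice GFF on ℤ³ pinned on
Bernoulli(p) sites, Σ_x Cov(φ₀,φ_x | P) = E₀[τ_P]/(2d) and p·E₀[τ_P] → G(0,0) (annealed Bernoulli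
traps; range LLN), i.e. e → 1 exactly; hypotheses IsNondegenerateTwoPoint / IsMoebiusCovariant / 0 <
Δ are carried so that the killing-renormalisation junk
(IsingCFTDataRefutations.exists_degenerate_scalingLimit) and coincident-configuration freedom cannot
fire. [difficulty: XL] (why it might fail: Planted lattice conditioning must commute with the
scaling limit: U₄≡0 of the spin n-point limits has to force value-blind conditional covariances at
scale L*(p)→∞ (a conditional CLT for the pinned field); pins are lattice ±1 constraints, and a Δ>1/2
generalised-free limit has no lattice-GFF model.) [GarbanSepulveda2023, Newman1975Gaussian,
AizenmanDuminilCopinAnnals2021, Panis2023Triviality, arXiv:2504.01264,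
Literature.Barriers.CriticalPhenomena.IsingTrivialityFromDimensionFour]
#4 PlantedSusceptibilityFloor (crux) — e_* > 0, i.e. the lower half of the card's law χ_pin ≍ 1/p
(K2): there are c > 0 and p₀ > 0 such that for every p ∈ (0,p₀), for all L large, c ≤ e_L(⌈p·|box 3
L|⌉) — typical pins do not screen the critical state before the susceptibility budget 1/p is spent
(ξ_pin ≳ L*(p)); equivalently the average Cauchy–Schwarz/Jensen slack along the Riccati flow stays
bounded. Guard for r2/r3: if this fails, r2 is trivial and r3 is false for a non-Gaussian reason.
[difficulty: L] (why it might fail: χ_pin ≥ c/p needs an UPPER bound on the two-replica correlation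
E[σ₀σ'_x] out to |x|≍L*(p); no GHS/FKG/Lebowitz inequality is known for the planted replica pair,
and intermittent locking (unbounded CS slack) would give χ_pin = o(1/p) along a sequence p→0.)
[arXiv:2504.01264, DuminilcopinPanis2025, FriedliVelenik2017, DingSongSun2022, arXiv:2109.00709]
#5 MoebiusLimitExists (crux) — IMPORTED COMPLEMENT (lowest rank; verbatim the shared item
stmt-CriticalPhenomena-1344 of PerfectScreening / DiracCensus / GammaForcesInteraction /
EnergyNotSigmaSquared / AnomalousForcesInteraction, so the gate attaches this route): the critical
Ising correlators on ℤ³ have a non-degenerate pointwise scaling limit (ρ > 0 on (0,1], Δ > 0, S)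
that is Möbius covariant with dimension Δ — the conjunct minus clause (iii). This route does not
attack existence or covariance. [difficulty: open-problem] (why it might fail: Existence of the full
δ→0⁺ limit (all n), O(3) invariance and inversion covariance are each open on ℤ³ (ICM 2022 §8.4
p.29); no uniqueness mechanism in d=3; inherits ScaleCovarianceNotMoebius / LiouvilleRigidity /
BootstrapLatticeBlindness unmitigated.) [DuminilCopinICM2022, PolandRychkovVichi2019,
stmt-CriticalPhenomena-1344, Literature.Barriers.CriticalPhenomena.ScaleCovarianceNotMoebius]
#9 PinningLemmaCeiling (support) — THE CEILING, abstract form (card P1; the pinning lemma with its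
constant): for every n, every probability weight w on {±1}^n (coded Fin n → Bool), M = Σ_i σ_i and
every 1 ≤ k ≤ n, the average over k-subsets P and over w-distributed patterns τ of Var_w(M | σ_P =
τ_P) is at most (n+1)(n−k+1)/k. Proof (≈ 1 page, finite sums): adding one uniformly random unpinned
pin lowers E Var by E[Cov(M,σ_z|·)²/Var(σ_z|·)] ≥ (E Var)²/(n−j)² (binary one-pin identity,
Var(σ_z|·) ≤ 1, Cauchy–Schwarz over z using Σ_{z∉P} Cov(M,σ_z|·) = Var(M|·), Jensen), so 1/v_{j+1} ≥
1/v_j + 1/(n−j)² and 1/v_k ≥ Σ_{j<k} 1/((n−j)(n−j+1)) = k/((n+1)(n−k+1)). [difficulty: provable-now]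
[arXiv:0709.0145, doi:10.1137/1.9781611973099.33, arXiv:2109.00709]
#9 PinningEfficiencyLeOne (support) — THE CEILING, Ising instance: 0 ≤ e_L(k) ≤ 1 for all L and 1 ≤
k ≤ |box 3 L| — PinningLemmaCeiling transported along a bijection Fin n ≃ box 3 L, plus the
finite-volume DLR identity "μ⁺_{Λ;β,0}( · | σ_P = η_P) = isingMeasure (Λ∖P) β 0 (.fixed η) for η = +
off Λ" (IsingConsistency: isingWeight_fixed_eq_mul, isingExpect_fixed_eq_of_separated) and
isingMeasure_real_singleton (weights w_τ = isingWeight/Z). Validates the normalisation of e used by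
r2–r4. [difficulty: provable-now] [FriedliVelenik2017, arXiv:0709.0145,
doi:10.1137/1.9781611973099.33]

TWO-LAYER PLAN. Foreseen glued splits (none filed now): PinningEfficiencyDeficit ⇐ SlackLowerBound
(a p-uniform lower bound on the Cauchy–Schwarz
slack Var_z Cov(M,σ_z|pins)/(E_z Cov)² at pin density p, from a 4-spin/two-replica quantity) →
RiccatiWithSlack (1/v_{j+1} − 1/v_j ≥
(1+s_j)/(n−j)² integrates to e ≤ 1/(1+s̄)) → PinningEfficiencyDeficit. GaussianPinningSaturation ⇐
LatticeGFFBenchmark (p·E₀[τ_P] →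
G(0,0) for Bernoulli(p) traps on ℤ³; Donsker–Varadhan tails are lower order) → ConditionalCLT (U₄ ≡
0 + non-degeneracy ⇒ conditional
covariances given planted pins are value-blind to o(1) at scale L*(p)) → GaussianPinningSaturation.
PlantedSusceptibilityFloor ⇐
ReplicaPairUpperBound (E[σ₀σ'_x] ≤ (1−c)⟨σ₀σ_x⟩ for |x| ≤ c'L*(p)) → TwoPointMass
(Σ_{|x|≤L*}⟨σ₀σ_x⟩_{β_c} ≥ c/p, from the DCP lower
bounds) → PlantedSusceptibilityFloor. The card's FLOOR K1 (Dobrushin contrapositive: for S = bℤ³ and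
every t > 0,
sup_x Σ_y e^{t|x−y|} C^{(b)}_{xy} ≥ 1 for the Dobrushin matrix of the decimated critical
specification ⇒ worst-case screening length
ξ^w ≥ L_scr/log) is deliberately deferred: it needs the decimated specification (route
SignedFieldRestoration, crux
SqueezeToQuasilocal) and a `dobrushinMatrix` notion; once both exist it is filed here as a rank-6
infrastructure crux typed over
DobrushinComparison.lean.

KILL CRITERIA. (a) A replica Monte Carlo of e_L(⌈pn⌉) at β_c(3) = 0.22165463, L = 64–128, p =
0.002…0.05 (two replicas sharing planted pins;
e = (k/n²)·Σ_{x,y}(⟨σ_xσ_y⟩ − ⟨σ_xσ'_y⟩) up to the (n+1)(n−k+1) normalisation) converging to 1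
within errors with no downward trend
⇒ r2 numerically dead: close `refuted:PinningEfficiencyDeficit` unless a proof-level slack bound
exists; the support items survive as
Literature-worthy lemmas. (b) The same estimate trending to 0 like a power of p ⇒ r4 dead and r3
false for a non-Gaussian reason ⇒
close (the gauge does not separate). (c) A theorem `¬GaussianPinningSaturation` (e.g. a
reflection-positive Gaussian-limit model on
ℤ³ — long-range α < 3/2, Panis2023Triviality — with e* < 1 computed rigorously) refutes the
principle behind r3 (r3 itself is stated for the n.n. model) ⇒ pivot r3 to an
explicitly finite-range mechanism or close. (d) HasNontrivialU4 for every non-degenerate limit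
proved elsewhere (IsingEuclidUpgrade r4, stmt-0636) moots the
route's conjunct value; r2/r4 and the ceiling remain wanted as statements about the planted axis.

NOT DECOMPOSED YET. The slack decomposition of 1 − e (Cauchy–Schwarz + Jensen + Var(σ_z|·) < 1
contributions) and its two-replica/4-spin expression; the
lattice-GFF benchmark p·E₀[τ_P] → G(0,0) (random walk range LLN; a support item once SRW
hitting-time vocabulary is settled); the
Bernoulli(p)-pins and torus variants of e (asymptotically equivalent, not filed to keep one
normalised signature); the infinite-volume
objects χ_pin(p), ξ_pin(p), the overlap q(p) ≍ p^{2Δ_σ/(d−2Δ_σ)} and the entropy profile h(p) with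
Σ-rule ∫₀¹h = s (card (3), P2) —
dictionary statements whose exponent content belongs to the η-routes (IsingEuclidUpgrade r3) and is
NOT claimed here; the card's
Dobrushin–DSS FLOOR K1 and the dilution ceiling ξ^w ≤ ξ(ℤ³∖P, β_c) (see Two-layer plan: wait for
SignedFieldRestoration's specification
and a dobrushinMatrix definition); any d-uniform statement (the ceiling, e ≤ 1, is d- and
interaction-free BY DESIGN; only the VALUE
e* < 1 is d = 3-n.n.-specific and it sits in one crux, r2).

CHEAPEST FALSIFIER. The replica MC of Kill criterion (a): numpy/numba heat-bath or
Wolff-with-frozen-sites on L = 48–64 at β_c(3), p ∈ {0.004, 0.008,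
0.016, 0.032}, 10³ planted samples × 2 replicas, estimator e ≈ (p/n)·Σ_{x,y∈Λ}(σ_xσ_y − σ_xσ'_y)
restricted to unpinned sites; the
dictionary predicts a p-flat value in (0,1), the ceiling forbids > 1, r2 dies if the plateau is at
1, r4 dies if it drifts to 0 like
p^{γ_pin−1}. The card ran the 2D analogue (p·χ_pin = 0.27/0.23/0.28/0.26/0.31 over p ∈ [0.005,0.08],
flat, far below 1) and a crude
3D L = 28 run (0.4–0.8, under the ceiling); its 3D kit jobs j000060/j000061 (L = 40, 64) belong to
the card's author and should be
attached to r2 as evidence when fetched. Not re-run here (compute queue saturated at filing;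
one-shot plancard).

NUMBERS. β_c(3) = 0.221654626(5); Δ_σ = 0.5181489(10) so d − 2Δ_σ = 2 − η = 1.963702, ν_pin :=
1/(d−2Δ_σ) = 0.50924, overlap exponent
2Δ_σ/(d−2Δ_σ) = 0.5277 (card's 3D fit 0.55–0.65 at L = 28); ceiling e ≤ 1 ⇔ χ_pin ≤
(1−p)/p·(1+O(1/n)); lattice GFF: G(0,0) =
1.516386 (SRW Green function), e_GFF → 1; 2D check value e ≈ 0.27 (η = 1/4, strongly non-Gaussian).
Items at open: 7 (4 cruxes,
2 support, 1 assembly).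

DEFINITION REQUESTS. None needed for the filed items (all inline over isingWeight /
isingPartitionFunction / isingExpect / glue / box / criticalBeta /
spinAt / Finset.powersetCard). Wanted later (not filed now, see Two-layer plan): `dobrushinMatrix (γ
: Specification V S) : V → V → ℝ`
(sup over boundary pairs differing at one site of the total-variation distance of the one-site
kernels; topic
Literature/Probability/LatticeModels, next to DobrushinComparison.lean) and a named
`plantedPinningEfficiency d L k β` abbreviating
the let-tower of r2–r4 (topic Summits/CriticalPhenomena/Ising3DConformalLimit/Theorems) if provers
ask for it.

Novelty: Searches (2026-08-15): `lit galaxy search "pinning lemma" --star all` (6: SOS notes, Miolane thesis,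
arXiv:2109.00709, a
correlation-rounding project — inference/TCS only); `lit galaxy search "randomly pinned" --star all`
(31: glasses, vortices, CDW —
none on critical ferromagnets); `lit galaxy search "random pinning Ising critical"|"Bayesian
critical points" --star all` (0);
`lit search --source arxiv "Bayesian critical points classical lattice models measurement
Nishimori"` (1: arXiv:2504.01264, READ pp.
2–3, 8, 11, 13, 45); `lit search --source arxiv "Nishimori measurement critical Ising replica"
--year-from 2020` (5: arXiv:2604.23346
READ p.1 + refs, arXiv:2504.12385 READ pp.1–2, arXiv:2604.06324, arXiv:2607.18374,
arXiv:2504.01264); `lit search --source arxiv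
"Montanari estimating random variables from random sparse observations"` (1: arXiv:0709.0145); three
further arXiv phrasings
("Ising conditioned on fraction of spins planted pinning…", "partial quench conditioned ensemble
critical Ising…") 0 hits; OpenAlex 429
(daily budget); `lit frontier CriticalPhenomena --since 2023` (30 newest descendants, none on
conditioned/measured ensembles); `lit
bridges CriticalPhenomena --cross any`; all 38 Theses of the sub grepped for
pinn/Nishimori/planted/erasure/Dobrushin (no route on this
object; SignedFieldRestoration = worst-case quasilocality via DSS, complementary); negatives index
read (1 SAW item).
Nearest prior art found: arXiv:2504.01264 (Nahum–Jacobsen, PRB 112 (2025) 2351  [refs: 10.1103/7dpt-d4s5, 10.1137/1.9781611973099.33, 10.1073/pnas.1111582109, 2109.00709, 2504.01264, 2604.23346, 2504.12385, 2604.06324, 2607.18374, 0709.0145, doi:10.1103/7dpt-d4s5, doi:10.1137/1.9781611973099.33, doi:10.1073/pnas.1111582109, GarbanSepulveda2023]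

Barriers (technique_class: planted-pinning, pinning-lemma, gaussianity-gauge): - technique_class: planted-pinning, pinning-lemma, gaussianity-gauge
- Literature.Barriers.CriticalPhenomena.IsingTrivialityFromDimensionFour: APPLIES to any
dimension-uniform non-triviality argument and is respected by design — the ceiling (support items),
the normalisation 0 ≤ e ≤ 1 and the Gaussian value e* = 1 are d- and interaction-uniform and TRUE in
d ≥ 5 (where the prediction is e* = 1, consistent with triviality); the only d = 3-specific input is
the VALUE e* < 1, isolated in one crux (r2), whose proof must use d < 4 (a slack lower bound from a
genuinely interacting crossover).
- Literature.Barriers.CriticalPhenomena.LongRangeTrivialityOnZ3: APPLIES to interaction-uniform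
arguments on ℤ³: for reflection-positive |x|^{−3−α} couplings with α < 3/2 the limit is Gaussian, so
r3 predicts e* = 1 THERE; r2's proof must therefore use the nearest-neighbour (or at least α > 3/2)
structure — conceded, and it is Kill criterion (c) if e* < 1 can be shown for such a model.
- Literature.Barriers.CriticalPhenomena.PositionSpaceRGNonGibbsian: not met as an obstruction — no
renormalised Hamiltonian is formed; the line quantifies the constrained system at PLANTED (typical)
image configurations by conditional variances, outside the class "R : H ↦ H′ single-valued on B¹";
the worst-case complement is route SignedFieldRestoration, whose specification this route will reuse
for the deferred floor.
- Literature.Barriers.CriticalPhenomena.RigorousRGSmallParameter: it does not evade it; the be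

Novelty grade: new-combination — ROUTE REVIEW (refuter-rreview d17a2435, 2026-08-15) — VERDICT: KEEP OPEN; sound thin route (7 items, 2 layers); all 7 decls ELABORATE (rc0, per-item stamps filed with briefings); Assembly PROVED sorry-free in reviewer scratch (pure logic) and attached as text in the 8456 stamp note. NOT a recombinat (refuter refuter-rreview-route-CriticalPhenomena--d17a2435-0, 2026-08-15T13:59:00Z; prior: arXiv:0709.0145 (Montanari 2008, pinning/sparse observations), doi:10.1137/1.9781611973099.33 (Raghavendra–Tan SODA 2012, pinning lemma), arXiv:2109.00709 (El Alaoui–Montanari, erasure decomposition eqs (1.4)-(1.6)), arXiv:2504.01264 (Nahum–Jacobsen, Bayesian critical points / partial quench), GarbanSepulveda2023)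

History (route lifecycle, newest last):
- 2026-08-25T13:12:10Z · DORMANT — reconciler: no traction for 7.7 d (last activity item-evidence-added at 2026-08-17T19:15:43Z); parked, not closed — `ledger route dormant route-CriticalPhenomen (operator:999:1263820)
- 2026-08-27T19:36:20Z · REACTIVATED — reconciler: reactivated — activity statement-checked at 2026-08-27T17:30:33Z after parking at 2026-08-25T13:12:10Z (operator:999:3987197)
- 2026-08-29T19:35:42Z · DORMANT — census g0: costume|duplicate of —; reader census-reader-39-g0 (operator:999:1363411)
- 2026-08-29T21:06:45Z · REACTIVATED — census: dormancy REVERTED — g1 reader + census-trib-costume-C class it NOT-COSTUME (21-frontier 20:08:25Z: no single-read elimination) (operator:999:1985533)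
- 2026-09-03T14:42:36Z · DORMANT — reconciler: no traction for 5 d (last activity statement-checked at 2026-08-29T14:02:40Z); parked, not closed — `ledger route dormant route-CriticalPhenomena-Pl (operator:999:31494)

sub-problem: Ising3DConformalLimit · status: dormant · opened planner-plancard-CriticalPhenomena-Ising3DCon-8a141737-0 2026-08-15T12:50:35Z · rev 2 · ledger route-CriticalPhenomena-PlantedPinning
GENERATED by the gate from the ledger (D-0016/17). Provers cite these decls: `theorem foo : Summit.CriticalPhenomena.Ising3DConformalLimit.Theses.PlantedPinning.<Decl> := …` in Summits/CriticalPhenomena/Ising3DConformalLimit/Theorems/<Name>.lean.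
-/

namespace Summit.CriticalPhenomena.Ising3DConformalLimit.Theses.PlantedPinning

open scoped BigOperators Topology Manifold Classical MeasureTheory ProbabilityTheory Matrix InnerProductSpace ComplexConjugate ContinuousMap
open Filter Set Function TopologicalSpace MeasureTheory

attribute [summit_statement] _root_.Ising3DConformalLimit

/-- item stmt-CriticalPhenomena-8451 · crux · rank 2 · open · by planner
why it might fail: e*=1 iff the CS/Jensen slack (relative variance over pins and values of the local conditional susceptibility χ_z at scale L*(p)≍p^{-0.51}) →0 as p→0; frustration-free planted ensembles may self-average like the GFF (two screening walks share ≍p^{1/2} of their traps); only MC: 2D e≈0.27, 3D 0.4–0.8.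
sources: arXiv:2504.01264, arXiv:0709.0145, doi:10.1137/1.9781611973099.33, arXiv:2109.00709, doi:10.1103/PhysRevLett.77.3700, DuminilCopinICM2022
[crux] e* < 1 for the critical n.n. Ising model on ℤ³ (card "e* < 1", the content of K3(b)'s
criterion): there are ε > 0 and p₀ > 0 such that for every p ∈ (0, p₀), for all L large, e_L(⌈p·|box
3 L|⌉) ≤ 1 − ε, where e_L(k) = k·v_{L,k}/((n+1)(n−k+1)) and v_{L,k} is the planted conditional
variance of M_Λ = Σ_{x∈Λ_L} σ_x averaged over uniform k-subsets P and over σ* ~ μ⁺_{Λ_L;β_c(3),0}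
(conditional law = Ising measure on Λ_L∖P with boundary condition fixed to glue Λ_L σ* plus).
[difficulty: open-problem] -/
@[route_item "route-CriticalPhenomena-PlantedPinning"]
def PinningEfficiencyDeficit : Prop :=
  let βc : ℝ := Literature.Probability.LatticeModels.criticalBeta 3; let M : ℕ → Literature.Probability.LatticeModels.SpinConfig (Literature.Probability.LatticeModels.Site 3) → ℝ := fun L σ => ∑ x ∈ Literature.Probability.LatticeModels.box 3 L, Literature.Probability.LatticeModels.spinAt x σ; let cvar : ℕ → Finset (Literature.Probability.LatticeModels.Site 3) → Literature.Probability.LatticeModels.SpinConfig (Literature.Probability.LatticeModels.Site 3) → ℝ := fun L P η => Literature.Probability.LatticeModels.isingExpect (Literature.Probability.LatticeModels.zdGraph 3) (Literature.Probability.LatticeModels.box 3 L \ P) βc 0 (.fixed η) (fun σ => M L σ ^ 2) - Literature.Probability.LatticeModels.isingExpect (Literature.Probability.LatticeModels.zdGraph 3) (Literature.Probability.LatticeModels.box 3 L \ P) βc 0 (.fixed η) (M L) ^ 2; let pvar : ℕ → ℕ → ℝ := fun L k => (∑ P ∈ (Literature.Probability.LatticeModels.box 3 L).powersetCard k, ∑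 τ : ↥(Literature.Probability.LatticeModels.box 3 L) → ℤˣ, Literature.Probability.LatticeModels.isingWeight (Literature.Probability.LatticeModels.zdGraph 3) (Literature.Probability.LatticeModels.box 3 L) βc 0 .plus τ / Literature.Probability.LatticeModels.isingPartitionFunction (Literature.Probability.LatticeModels.zdGraph 3) (Literature.Probability.LatticeModels.box 3 L) βc 0 .plus * cvar L P (Literature.Probability.LatticeModels.glue (Literature.Probability.LatticeModels.box 3 L) τ .plus)) / ((Literature.Probability.LatticeModels.box 3 L).card.choose k : ℝ); let eff : ℕ → ℕ → ℝ := fun L k => (k : ℝ) * pvar L k / ((((Literature.Probability.LatticeModels.box 3 L).card : ℝ) + 1) * (((Literature.Probability.LatticeModels.box 3 L).card : ℝ) - k + 1)); ∃ ε : ℝ, 0 < ε ∧ ∃ p₀ : ℝ, 0 < p₀ ∧ ∀ p : ℝ, 0 < p → p < p₀ → ∃ L₀ : ℕ, ∀ L ≥ L₀, eff L ⌈p * ((Literature.Probability.LatticeModels.box 3 L).card : ℝ)⌉₊ ≤ 1 - ε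

/-- item stmt-CriticalPhenomena-8452 · crux · rank 3 · open · by planner
why it might fail: Conclusion ignores S: given r2 the item ≡ ¬(non-degenerate Möbius Gaussian limit) = clause (iii) unless the mechanism is proved — fixed-n pointwise limits with U₄≡0 must control conditioning on ≍p·n lattice ±1 pins at scale L*(p)→∞ (a conditional CLT nobody has); Δ>1/2 free fields lack ±1 testbeds.
sources: Newman1975Gaussian, Aizenman1982, AizenmanDuminilCopinAnnals2021, Panis2023Triviality, Literature.Barriers.CriticalPhenomena.LongRangeTrivialityOnZ3, Literature.Barriers.CriticalPhenomena.IsingTrivialityFromDimensionFour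
[crux] Gaussian ⇒ saturation (card K3(b)): if (ρ, Δ, S) is a pointwise scaling limit of criticalCorr
3 with ρ > 0 on (0,1], Δ > 0, non-degenerate two-point function, Möbius covariant, and with
connected four-point function vanishing on all non-coincident configurations, then for every ε > 0
there is p₀ > 0 such that for every p ∈ (0,p₀), for all L large, 1 − ε ≤ e_L(⌈p·|box 3 L|⌉).
Benchmark: for the massless lattice GFF on ℤ³ pinned on Bernoulli(p) sites, Σ_x Cov(φ₀,φ_x | P) =
E₀[τ_P]/(2d) and p·E₀[τ_P] → G(0,0) (annealed Bernoulli traps; range LLN), i.e. e → 1 exactly;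
hypotheses IsNondegenerateTwoPoint / IsMoebiusCovariant / 0 < Δ are carried so that the
killing-renormalisation junk (IsingCFTDataRefutations.exists_degenerate_scalingLimit) and
coincident-configuration freedom cannot fire. [difficulty: XL] -/
@[route_item "route-CriticalPhenomena-PlantedPinning"]
def GaussianPinningSaturation : Prop :=
  let βc : ℝ := Literature.Probability.LatticeModels.criticalBeta 3; let M : ℕ → Literature.Probability.LatticeModels.SpinConfig (Literature.Probability.LatticeModels.Site 3) → ℝ := fun L σ => ∑ x ∈ Literature.Probability.LatticeModels.box 3 L, Literature.Probability.LatticeModels.spinAt x σ; let cvar : ℕ → Finset (Literature.Probability.LatticeModels.Site 3) → Literature.Probability.LatticeModels.SpinConfig (Literature.Probability.LatticeModels.Site 3) → ℝ := fun L P η => Literature.Probability.LatticeModels.isingExpect (Literature.Probability.LatticeModels.zdGraph 3) (Literature.Probability.LatticeModels.box 3 L \ P) βc 0 (.fixed η) (fun σ => M L σ ^ 2) - Literature.Probability.LatticeModels.isingExpect (Literature.Probability.LatticeModels.zdGraph 3) (Literature.Probability.LatticeModels.box 3 L \ P) βc 0 (.fixed η) (M L) ^ 2; let pvar : ℕ →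 ℕ → ℝ := fun L k => (∑ P ∈ (Literature.Probability.LatticeModels.box 3 L).powersetCard k, ∑ τ : ↥(Literature.Probability.LatticeModels.box 3 L) → ℤˣ, Literature.Probability.LatticeModels.isingWeight (Literature.Probability.LatticeModels.zdGraph 3) (Literature.Probability.LatticeModels.box 3 L) βc 0 .plus τ / Literature.Probability.LatticeModels.isingPartitionFunction (Literature.Probability.LatticeModels.zdGraph 3) (Literature.Probability.LatticeModels.box 3 L) βc 0 .plus * cvar L P (Literature.Probability.LatticeModels.glue (Literature.Probability.LatticeModels.box 3 L) τ .plus)) / ((Literature.Probability.LatticeModels.box 3 L).card.choose k : ℝ); let eff : ℕ → ℕ → ℝ := fun L k => (k : ℝ) * pvar L k / ((((Literature.Probability.LatticeModels.box 3 L).card : ℝ) + 1) * (((Literature.Probability.LatticeModels.box 3 L).card : ℝ) - k + 1)); ∀ (ρ : ℝ → ℝ) (Δ : ℝ) (S : Literature.Probability.LatticeModels.CorrFamily 3), (∀ δ ∈ Set.Ioc (0:ℝ) 1, 0 < ρ δ) → 0 < Δ → Literature.Probability.LatticeModels.HasPointwiseScalingLimit (Literature.Probability.LatticeModels.criticalCorr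 3) ρ S → Literature.Probability.LatticeModels.IsNondegenerateTwoPoint S → Literature.Probability.LatticeModels.IsMoebiusCovariant Δ S → ¬ Literature.Probability.LatticeModels.HasNontrivialU4 S → ∀ ε : ℝ, 0 < ε → ∃ p₀ : ℝ, 0 < p₀ ∧ ∀ p : ℝ, 0 < p → p < p₀ → ∃ L₀ : ℕ, ∀ L ≥ L₀, 1 - ε ≤ eff L ⌈p * ((Literature.Probability.LatticeModels.box 3 L).card : ℝ)⌉₊

/-- item stmt-CriticalPhenomena-8453 · crux · rank 4 · open · by planner
why it might fail: χ_pin ≥ c/p needs an UPPER bound on the two-replica correlation E[σ₀σ'_x] (bounded intermittency of χ_z) out to |x|≍L*(p); no GHS/FKG/Lebowitz/Ding–Song–Sun inequality controls the planted replica pair; intermittent locking would give χ_pin=o(1/p) along p→0, making r2 trivial and r3 false.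
sources: arXiv:2504.01264, DuminilcopinPanis2025, DingSongSun2022, FriedliVelenik2017, arXiv:0709.0145
[crux] e_* > 0, i.e. the lower half of the card's law χ_pin ≍ 1/p (K2): there are c > 0 and p₀ > 0
such that for every p ∈ (0,p₀), for all L large, c ≤ e_L(⌈p·|box 3 L|⌉) — typical pins do not screen
the critical state before the susceptibility budget 1/p is spent (ξ_pin ≳ L*(p)); equivalently the
average Cauchy–Schwarz/Jensen slack along the Riccati flow stays bounded. Guard for r2/r3: if this
fails, r2 is trivial and r3 is false for a non-Gaussian reason. [difficulty: L] -/
@[route_item "route-CriticalPhenomena-PlantedPinning"]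
def PlantedSusceptibilityFloor : Prop :=
  let βc : ℝ := Literature.Probability.LatticeModels.criticalBeta 3; let M : ℕ → Literature.Probability.LatticeModels.SpinConfig (Literature.Probability.LatticeModels.Site 3) → ℝ := fun L σ => ∑ x ∈ Literature.Probability.LatticeModels.box 3 L, Literature.Probability.LatticeModels.spinAt x σ; let cvar : ℕ → Finset (Literature.Probability.LatticeModels.Site 3) → Literature.Probability.LatticeModels.SpinConfig (Literature.Probability.LatticeModels.Site 3) → ℝ := fun L P η => Literature.Probability.LatticeModels.isingExpect (Literature.Probability.LatticeModels.zdGraph 3) (Literature.Probability.LatticeModels.box 3 L \ P) βc 0 (.fixed η) (fun σ => M L σ ^ 2) - Literature.Probability.LatticeModels.isingExpect (Literature.Probability.LatticeModels.zdGraph 3) (Literature.Probability.LatticeModels.box 3 L \ P) βc 0 (.fixed η) (M L) ^ 2; let pvar : ℕ → ℕ → ℝ := fun L k => (∑ P ∈ (Literature.Probability.LatticeModels.box 3 L).powersetCard k, ∑ τ : ↥(Literature.Probability.LatticeModels.box 3 L) → ℤˣ, Literature.Probability.LatticeModels.isingWeight (Literature.Probability.LatticeModels.zdGraph 3) (Literature.Probability.LatticeModels.box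 3 L) βc 0 .plus τ / Literature.Probability.LatticeModels.isingPartitionFunction (Literature.Probability.LatticeModels.zdGraph 3) (Literature.Probability.LatticeModels.box 3 L) βc 0 .plus * cvar L P (Literature.Probability.LatticeModels.glue (Literature.Probability.LatticeModels.box 3 L) τ .plus)) / ((Literature.Probability.LatticeModels.box 3 L).card.choose k : ℝ); let eff : ℕ → ℕ → ℝ := fun L k => (k : ℝ) * pvar L k / ((((Literature.Probability.LatticeModels.box 3 L).card : ℝ) + 1) * (((Literature.Probability.LatticeModels.box 3 L).card : ℝ) - k + 1)); ∃ c : ℝ, 0 < c ∧ ∃ p₀ : ℝ, 0 < p₀ ∧ ∀ p : ℝ, 0 < p → p < p₀ → ∃ L₀ : ℕ, ∀ L ≥ L₀, c ≤ eff L ⌈p * ((Literature.Probability.LatticeModels.box 3 L).card : ℝ)⌉₊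

/-- item stmt-CriticalPhenomena-1344 · crux · rank 5 · open · by planner
why it might fail: Existence of the full δ→0⁺ limit (one ρ, all n), O(3) invariance and inversion covariance are each open on ℤ³ (ICM 2022 §8.4 p.29); no uniqueness mechanism in d=3; Euclidean+scale data never force inversion (ScaleCovarianceNotMoebius_holds); imported here, not attacked.
sources: DuminilCopinICM2022, PolandRychkovVichi2019, Literature.Barriers.CriticalPhenomena.ScaleCovarianceNotMoebius, Literature.Barriers.CriticalPhenomena.LiouvilleRigidity, Literature.Probability.LatticeModels.CritIsing3DEuclideanLimit
[crux] r5 = MoebLim (IMPORTED COMPLEMENT, lowest rank): the critical Ising correlators on ℤ³ have a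
non-degenerate pointwise scaling limit (ρ > 0 on (0,1], Δ > 0, S) that is Möbius covariant with
dimension Δ — the conjunct Ising3DConformalLimit minus clause (iii). Written verbatim as the
conjunct's definiens without '∧ HasNontrivialU4 S' so that other routes filing the same complement
attach here. This route does not attack existence, rotation or inversion covariance; it bets on the
covariance lines (IsingEuclidUpgrade r5/r6 = items 0637/0638, IsingCFTData r2 = 0665, cards
hyperoctahedral-rp-rigidity / inversion-first-moebius-from-translations). S may be taken 0 off
NonCoincident, so no coincident-configuration junk obstructs the existential. -/
@[route_item "route-CriticalPhenomena-PlantedPinning"]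
def MoebiusLimitExists : Prop :=
  ∃ (ρ : ℝ → ℝ) (Δ : ℝ) (S : Literature.Probability.LatticeModels.CorrFamily 3), (∀ δ ∈ Set.Ioc (0:ℝ) 1, 0 < ρ δ) ∧ 0 < Δ ∧ Literature.Probability.LatticeModels.HasPointwiseScalingLimit (Literature.Probability.LatticeModels.criticalCorr 3) ρ S ∧ Literature.Probability.LatticeModels.IsNondegenerateTwoPoint S ∧ Literature.Probability.LatticeModels.IsMoebiusCovariant Δ S

/-- item stmt-CriticalPhenomena-8454 · support · rank 9 · closed · proved by Summit.CriticalPhenomena.Ising3DConformalLimit.Theorems.pinningLemmaCeiling_proof @ 9c1c2984f467 (prover) · by planner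
sources: arXiv:0709.0145, doi:10.1137/1.9781611973099.33, arXiv:2109.00709
[support] THE CEILING, abstract form (card P1; the pinning lemma with its constant): for every n,
every probability weight w on {±1}^n (coded Fin n → Bool), M = Σ_i σ_i and every 1 ≤ k ≤ n, the
average over k-subsets P and over w-distributed patterns τ of Var_w(M | σ_P = τ_P) is at most
(n+1)(n−k+1)/k. Proof (≈ 1 page, finite sums): adding one uniformly random unpinned pin lowers E Var
by E[Cov(M,σ_z|·)²/Var(σ_z|·)] ≥ (E Var)²/(n−j)² (binary one-pin identity, Var(σ_z|·) ≤ 1,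
Cauchy–Schwarz over z using Σ_{z∉P} Cov(M,σ_z|·) = Var(M|·), Jensen), so 1/v_{j+1} ≥ 1/v_j +
1/(n−j)² and 1/v_k ≥ Σ_{j<k} 1/((n−j)(n−j+1)) = k/((n+1)(n−k+1)). [difficulty: provable-now] -/
@[route_item "route-CriticalPhenomena-PlantedPinning"]
def PinningLemmaCeiling : Prop :=
  ∀ (n k : ℕ) (w : (Fin n → Bool) → ℝ), 1 ≤ k → k ≤ n → (∀ σ, 0 ≤ w σ) → ∑ σ, w σ = 1 → let M : (Fin n → Bool) → ℝ := fun σ => ∑ i, (if σ i then (1:ℝ) else -1); let Z : Finset (Fin n) → (Fin n → Bool) → ℝ := fun P τ => ∑ σ, (if (∀ i ∈ P, σ i = τ i) then w σ else 0); let E1 : Finset (Fin n) → (Fin n → Bool) → ℝ := fun P τ => (∑ σ, (if (∀ i ∈ P, σ i = τ i) then w σ * M σ else 0)) / Z P τ; let E2 : Finset (Fin n) → (Fin n → Bool) → ℝ := fun P τ => (∑ σ, (if (∀ i ∈ P, σ i = τ i) then w σ * M σ ^ 2 else 0)) / Z P τ; (k : ℝ) * (∑ P ∈ (Finset.univ :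 Finset (Fin n)).powersetCard k, ∑ τ, w τ * (E2 P τ - E1 P τ ^ 2)) / (n.choose k : ℝ) ≤ ((n : ℝ) + 1) * ((n : ℝ) - k + 1)

-- `PinningLemmaCeiling` holds: proved by `Summit.CriticalPhenomena.Ising3DConformalLimit.Theorems.pinningLemmaCeiling_proof` @ 9c1c2984f467 (its module imports this route file, so no `_holds` link can be stated here).

/-- item stmt-CriticalPhenomena-8455 · support · rank 9 · closed · proved by Summit.CriticalPhenomena.Ising3DConformalLimit.PlantedPinningCeiling.pinningEfficiencyLeOne_proof @ 3319ff56175d (prover) · by planner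
sources: FriedliVelenik2017, arXiv:0709.0145, doi:10.1137/1.9781611973099.33
[support] THE CEILING, Ising instance: 0 ≤ e_L(k) ≤ 1 for all L and 1 ≤ k ≤ |box 3 L| —
PinningLemmaCeiling transported along a bijection Fin n ≃ box 3 L, plus the finite-volume DLR
identity "μ⁺_{Λ;β,0}( · | σ_P = η_P) = isingMeasure (Λ∖P) β 0 (.fixed η) for η = + off Λ"
(IsingConsistency: isingWeight_fixed_eq_mul, isingExpect_fixed_eq_of_separated) and
isingMeasure_real_singleton (weights w_τ = isingWeight/Z). Validates the normalisation of e used by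
r2–r4. [difficulty: provable-now] -/
@[route_item "route-CriticalPhenomena-PlantedPinning"]
def PinningEfficiencyLeOne : Prop :=
  let βc : ℝ := Literature.Probability.LatticeModels.criticalBeta 3; let M : ℕ → Literature.Probability.LatticeModels.SpinConfig (Literature.Probability.LatticeModels.Site 3) → ℝ := fun L σ => ∑ x ∈ Literature.Probability.LatticeModels.box 3 L, Literature.Probability.LatticeModels.spinAt x σ; let cvar : ℕ → Finset (Literature.Probability.LatticeModels.Site 3) → Literature.Probability.LatticeModels.SpinConfig (Literature.Probability.LatticeModels.Site 3) → ℝ := fun L P η => Literature.Probability.LatticeModels.isingExpect (Literature.Probability.LatticeModels.zdGraph 3) (Literature.Probability.LatticeModels.box 3 L \ P) βc 0 (.fixed η) (fun σ => M L σ ^ 2) - Literature.Probability.LatticeModels.isingExpect (Literature.Probability.LatticeModels.zdGraph 3) (Literature.Probability.LatticeModels.box 3 L \ P) βc 0 (.fixed η) (M L) ^ 2; let pvar : ℕ → ℕ → ℝ := fun L k => (∑ P ∈ (Literature.Probability.LatticeModels.box 3 L).powersetCard k, ∑ τ : ↥(Literature.Probability.LatticeModels.box 3 L) → ℤˣ,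 Literature.Probability.LatticeModels.isingWeight (Literature.Probability.LatticeModels.zdGraph 3) (Literature.Probability.LatticeModels.box 3 L) βc 0 .plus τ / Literature.Probability.LatticeModels.isingPartitionFunction (Literature.Probability.LatticeModels.zdGraph 3) (Literature.Probability.LatticeModels.box 3 L) βc 0 .plus * cvar L P (Literature.Probability.LatticeModels.glue (Literature.Probability.LatticeModels.box 3 L) τ .plus)) / ((Literature.Probability.LatticeModels.box 3 L).card.choose k : ℝ); let eff : ℕ → ℕ → ℝ := fun L k => (k : ℝ) * pvar L k / ((((Literature.Probability.LatticeModels.box 3 L).card : ℝ) + 1) * (((Literature.Probability.LatticeModels.box 3 L).card : ℝ) - k + 1)); ∀ L k : ℕ, 1 ≤ k → k ≤ (Literature.Probability.LatticeModels.box 3 L).card → 0 ≤ eff L k ∧ eff L k ≤ 1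

-- `PinningEfficiencyLeOne` holds: proved by `Summit.CriticalPhenomena.Ising3DConformalLimit.PlantedPinningCeiling.pinningEfficiencyLeOne_proof` @ 3319ff56175d (its module imports this route file, so no `_holds` link can be stated here).

/-- item stmt-CriticalPhenomena-8456 · assembly · rank 1 · closed · proved by Summit.CriticalPhenomena.Ising3DConformalLimit.Theorems.plantedPinning_assembly_proof @ b133fb0dd31c (prover) · by planner
sources: DuminilCopinICM2022, arXiv:2504.01264
[assembly] PinningEfficiencyDeficit → GaussianPinningSaturation → MoebiusLimitExists →
Ising3DConformalLimit. -/
@[route_item "route-CriticalPhenomena-PlantedPinning"]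
def Assembly : Prop :=
  PinningEfficiencyDeficit → GaussianPinningSaturation → MoebiusLimitExists → Ising3DConformalLimit

-- `Assembly` holds: proved by `Summit.CriticalPhenomena.Ising3DConformalLimit.Theorems.plantedPinning_assembly_proof` @ b133fb0dd31c (its module imports this route file, so no `_holds` link can be stated here).

/-! D-0027 §2.1 — DECIDING THEOREM (planner-authored via `route open/edit --closes-file`; by planner-rbadge-CriticalPhenomena-PlantedPinnin-ea8b5db1-g4-0 2026-08-15T16:10:46Z):
its hypotheses are this route's items and its conclusion the sub-problem Statement (glue_lint), and it elaborates with this file. -/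

@[closes "route-CriticalPhenomena-PlantedPinning"] theorem closes : PinningEfficiencyDeficit → GaussianPinningSaturation → MoebiusLimitExists → _root_.Ising3DConformalLimit := by
  intro hDef hSat hMoeb
  obtain ⟨ρ, Δ, S, hρ, hΔ, hlim, hnd, hmob⟩ := hMoeb
  refine ⟨ρ, Δ, S, hρ, hΔ, hlim, hnd, hmob, ?_⟩
  by_contra hU4
  obtain ⟨ε, hε, p₀, hp₀, hdef⟩ := hDef
  obtain ⟨p₁, hp₁, hsat⟩ := hSat ρ Δ S hρ hΔ hlim hnd hmob hU4 (ε / 2) (by linarith)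
  have hmin : 0 < min p₀ p₁ := lt_min hp₀ hp₁
  have hle₀ : min p₀ p₁ ≤ p₀ := min_le_left p₀ p₁
  have hle₁ : min p₀ p₁ ≤ p₁ := min_le_right p₀ p₁
  obtain ⟨L₀, hL₀⟩ := hdef (min p₀ p₁ / 2) (by linarith) (by linarith)
  obtain ⟨L₁, hL₁⟩ := hsat (min p₀ p₁ / 2) (by linarith) (by linarith)
  have h₀ := hL₀ (max L₀ L₁) (le_max_left L₀ L₁)
  have h₁ := hL₁ (max L₀ L₁) (le_max_right L₀ L₁)
  linarith

end Summit.CriticalPhenomena.Ising3DConformalLimit.Theses.PlantedPinning
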